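import Summits.AtomisticToContinuum.FouriersLaw.Theorems.OddSectorIrreversibilityCorrectorTheoryUniformMixing
import Summits.AtomisticToContinuum.FouriersLaw.Theorems.ContactStieltjesMeasureStieltjesRepresentationStubBoundaryGreenKuboAux1

/-!
# Stub `stub_boundaryGreenKubo` of line `cayley-pencil` (crux `ContactStieltjesMeasure.StieltjesRepresentation`,
# stmt-AtomisticToContinuum-15248), part 2: `∫₀^∞ corr(J,J) = (N-1)² ∫₀^∞ corr(g₀,g₀)` and the stub

Helper file (`--supports stmt-AtomisticToContinuum-15248`). The open-chain Green–Kubo formula of the tree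
(`openChainGreenKubo_holds`, item stmt-12696: response limit `= ∫₀^∞corr(J,J)/((N-1)T²)`) is converted into its
BOUNDARY-POWER form: with the `γ`-free boundary power `g₀ = p_0 ∂_{q_0}H`,

  `∫₀^∞ corr(J,J) dt = (N-1)² ∫₀^∞ corr(g₀,g₀) dt`          (`integral_corr_totalCurrent_eq_sq_mul_boundaryPower`),

because `J = (N-1) g₀ + LΨ` for the smooth even corrector `Ψ` of part 1, `LΨ` pairs to zero against the Kubo integral of
any centred odd nice observable up to a static covariance that vanishes by parity (Abel-limit coboundary lemma of part 1),
and `∫₀^∞ ∫ J P_t g₀ = ∫₀^∞ ∫ g₀ P_t J` by kernel detailed balance (`pinnedChain_integral_mul_act_flip`). Hence the response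
limit is `(N-1)·∫₀^∞corr(g₀,g₀)/T²`, and `corr(g₀,g₀) ∈ L¹(0,∞)` (`pinnedChain_integrableOn_corr_nice`):
`stub_boundaryGreenKubo`. No definitions.
-/

noncomputable section

open MeasureTheory ProbabilityTheory Filter Topology Set Function
open scoped NNReal ENNReal ContDiff BigOperators

namespace Summit.AtomisticToContinuum.FouriersLaw.Theorems.ContactStieltjesMeasure.CayleyPencil

open Literature.MathematicalPhysics.KineticTheory.HeatConduction
open Literature.MathematicalPhysics.KineticTheory OscillatorChain
open Summit.AtomisticToContinuum.FouriersLaw.Theorems.SubdiffusiveBondHeat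
open Summit.AtomisticToContinuum.FouriersLaw.Theorems.OddSectorIrreversibility
open Summit.AtomisticToContinuum.FouriersLaw.Theorems.OddSectorIrreversibility.Corrector
open Summit.AtomisticToContinuum.FouriersLaw.Theorems.OpenChainGreenKubo
open Summit.AtomisticToContinuum.FouriersLaw.Theorems.HonestZwanzig
open Literature.Barriers.AtomisticToContinuum.OpenChain
open BoundaryGreenKubo

variable {N : ℕ}

section Pinned

variable {ω₂ lam β γ : ℝ} (hω : 0 < ω₂) (hl : 0 ≤ lam) (hβ : 0 < β) (hγ : 0 < γ) (hN : 2 ≤ N)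
  {T : ℝ} (hT : 0 < T)
include hω hl hβ hγ hN hT

/-- **`∫₀^∞ corr(J,J) = (N-1)² ∫₀^∞ corr(g₀,g₀)`** (fixed `N ≥ 2`, equilibrium kernels at `T > 0`), `J = Σ_i j_i` the total
current and `g₀ = p_0 ∂_{q_0}H` the boundary power, `corr(f,f)(t) = ∫ f P_t f dμ_T - μ_T(f)²`. Proof: `μ_T(J) = μ_T(g₀) = 0`
(oddness); Fubini turns both sides into Kubo pairings `∫ f R₀ f dμ_T`; `J = (N-1)g₀ + LΨ` with the even corrector `Ψ`
(`pinnedChain_generator_corrector`) and the Abel-limit coboundary lemma give `∫ J R₀J = (N-1)∫ J R₀g₀` and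
`∫ g₀ R₀J = (N-1)∫ g₀R₀g₀`; kernel detailed balance (`pinnedChain_integral_mul_act_flip`, both observables odd) gives
`∫ J R₀ g₀ = ∫ g₀ R₀ J`. [cite: KunduDharNarayan2009, p. 3] -/
theorem integral_corr_totalCurrent_eq_sq_mul_boundaryPower :
    (∫ t in Ioi (0 : ℝ),
        ((∫ z, (∑ i : Fin N, (pinnedChain ω₂ lam β γ).bondCurrent N i z) *
            (∫ y, ∑ i : Fin N, (pinnedChain ω₂ lam β γ).bondCurrent N i y
              ∂((pinnedChain ω₂ lam β γ).transitionKernel N T T t.toNNReal z))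
          ∂((pinnedChain ω₂ lam β γ).gibbsMeasure N T)) -
        (∫ z, ∑ i : Fin N, (pinnedChain ω₂ lam β γ).bondCurrent N i z
            ∂((pinnedChain ω₂ lam β γ).gibbsMeasure N T)) *
          (∫ z, ∑ i : Fin N, (pinnedChain ω₂ lam β γ).bondCurrent N i z
            ∂((pinnedChain ω₂ lam β γ).gibbsMeasure N T)))) =
      ((N : ℝ) - 1) ^ 2 * ∫ t in Ioi (0 : ℝ),
        ((∫ z, (z.2 ⟨0, by omega⟩ * partialQ ⟨0, by omega⟩ ((pinnedChain ω₂ lam β γ).hamiltonian N) z) *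
            (∫ y, y.2 ⟨0, by omega⟩ * partialQ ⟨0, by omega⟩ ((pinnedChain ω₂ lam β γ).hamiltonian N) y
              ∂((pinnedChain ω₂ lam β γ).transitionKernel N T T t.toNNReal z))
          ∂((pinnedChain ω₂ lam β γ).gibbsMeasure N T)) -
        (∫ z, z.2 ⟨0, by omega⟩ * partialQ ⟨0, by omega⟩ ((pinnedChain ω₂ lam β γ).hamiltonian N) z
            ∂((pinnedChain ω₂ lam β γ).gibbsMeasure N T)) *
          (∫ z, z.2 ⟨0, by omega⟩ * partialQ ⟨0, by omega⟩ ((pinnedChain ω₂ lam β γ).hamiltonian N) z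
            ∂((pinnedChain ω₂ lam β γ).gibbsMeasure N T))) := by
  set P := pinnedChain ω₂ lam β γ with hP
  set μ := P.gibbsMeasure N T with hμ
  have hN0 : 0 < N := by omega
  haveI : IsProbabilityMeasure μ := pinnedChain_isProbabilityMeasure_gibbsMeasure hω hl hβ.le γ N hT
  set J : PhaseSpace N → ℝ := fun y => ∑ i : Fin N, P.bondCurrent N i y with hJ
  set g₀ : PhaseSpace N → ℝ := fun y => y.2 ⟨0, hN0⟩ * partialQ ⟨0, hN0⟩ (P.hamiltonian N) y with hg₀
  -- exponent
  set ϑ : ℝ := 1 / T / 4 with hϑdef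
  have hT1 : 0 < 1 / T := by positivity
  have hϑ0 : 0 < ϑ := by positivity
  have h2ϑ : 2 * ϑ < 1 / T := by rw [hϑdef]; linarith
  -- the total current
  have hJc : Continuous J := continuous_totalBondCurrent ω₂ lam β γ N
  obtain ⟨CJ, hCJ0, hJb⟩ : ∃ CJ : ℝ, 0 ≤ CJ ∧ ∀ y, |J y| ≤ CJ * Real.exp (ϑ * P.hamiltonian N y) :=
    ⟨_, by positivity, fun y => pinnedChain_abs_totalCurrent_le hω hl hβ.le N hϑ0 y⟩
  have hJ0 : ∫ y, J y ∂μ = 0 := integral_totalBondCurrent_gibbsMeasure ω₂ lam β γ N T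
  have hJodd : ∀ z : PhaseSpace N, J (z.1, -z.2) = -J z := totalBondCurrent_neg_momentum P N
  -- the boundary power
  have hgc : Continuous g₀ := continuous_boundaryPower ω₂ lam β γ hN0
  obtain ⟨Cg, hCg0, hgb⟩ : ∃ Cg : ℝ, 0 ≤ Cg ∧ ∀ y, |g₀ y| ≤ Cg * Real.exp (ϑ * P.hamiltonian N y) :=
    abs_boundaryPower_le hω hl hβ.le hγ.le hN0 hϑ0
  have hgodd : ∀ z : PhaseSpace N, g₀ (z.1, -z.2) = -g₀ z := fun z => by
    simp only [hg₀, Pi.neg_apply, partialQ_hamiltonian_reversal, neg_mul]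
  have hg0 : ∫ y, g₀ y ∂μ = 0 := by
    have h := integral_comp_reversal_gibbsMeasure P N T g₀
    simp only [hgodd, integral_neg] at h
    linarith
  -- the corrector `Ψ`
  set Ψ : PhaseSpace N → ℝ := fun y => energyMoment P N y + (-((N : ℝ) - 1)) * P.hamiltonian N y +
    ((N : ℝ) - 1) * (y.2 ⟨0, hN0⟩ ^ 2 / 2) with hΨdef
  have hU : ContDiff ℝ ∞ P.U := pinnedChain_contDiff_U ω₂ lam β γ
  have hV : ContDiff ℝ ∞ P.V := pinnedChain_contDiff_V ω₂ lam β γ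
  have hΨinf : ContDiff ℝ ∞ Ψ :=
    ((contDiff_energyMoment P hU hV N).add (contDiff_const.mul (P.contDiff_hamiltonian hU hV N))).add
      (contDiff_const.mul ((((contDiff_apply ℝ ℝ (⟨0, hN0⟩ : Fin N)).comp contDiff_snd).pow 2).div_const 2))
  have hΨ2 : ContDiff ℝ 2 Ψ := hΨinf.of_le (by norm_cast)
  have hLΨ : ∀ x, P.generator N T T Ψ x = J x - ((N : ℝ) - 1) * g₀ x := fun x =>
    pinnedChain_generator_corrector hN T x
  have hCΨ0 : (0 : ℝ) ≤ 4 * N * (2 * Real.exp ϑ / ϑ ^ 2) := by positivity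
  have hΨb : ∀ y, |Ψ y| ≤ (4 * N * (2 * Real.exp ϑ / ϑ ^ 2)) * Real.exp (ϑ * P.hamiltonian N y) := fun y =>
    abs_corrector_le hω hl hβ.le γ hN hϑ0 y
  have hΨeven : ∀ z : PhaseSpace N, Ψ (z.1, -z.2) = Ψ z := fun z => by
    simp only [hΨdef, energyMoment_neg_momentum, OscillatorChain.hamiltonian_neg_momentum, Pi.neg_apply, neg_sq]
  have hLb : ∀ y, |P.generator N T T Ψ y| ≤ (CJ + |-((N : ℝ) - 1)| * Cg) * Real.exp (ϑ * P.hamiltonian N y) := by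
    intro y
    have h := abs_add_le_exp_bound hJb (abs_const_mul_le_exp_bound (-((N : ℝ) - 1)) hgb) y
    have e : J y + (-((N : ℝ) - 1)) * g₀ y = P.generator N T T Ψ y := by rw [hLΨ y]; ring
    rwa [e] at h
  have hCL0 : 0 ≤ CJ + |-((N : ℝ) - 1)| * Cg := by positivity
  -- parity: `∫ JΨ = ∫ g₀Ψ = 0`
  have hJΨ : ∫ z, J z * Ψ z ∂μ = 0 := by
    have h := integral_comp_reversal_gibbsMeasure P N T (fun z => J z * Ψ z)
    simp only [hJodd, hΨeven, neg_mul, integral_neg] at h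
    linarith
  have hgΨ : ∫ z, g₀ z * Ψ z ∂μ = 0 := by
    have h := integral_comp_reversal_gibbsMeasure P N T (fun z => g₀ z * Ψ z)
    simp only [hgodd, hΨeven, neg_mul, integral_neg] at h
    linarith
  -- `J = (N-1) g₀ + LΨ` and the two coboundary expansions
  have hJeq : ∀ y, J y = ((N : ℝ) - 1) * g₀ y + P.generator N T T Ψ y := fun y => by rw [hLΨ y]; ring
  have s1 := integral_mul_kubo_eq_of_coboundary hω hl hβ hγ hN hT hϑ0 h2ϑ hJc hJc hgc hΨ2 hCJ0 hCg0 hCΨ0 hCL0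
    hJb hJb hgb hΨb hLb ((N : ℝ) - 1) hJeq hJ0 hJ0 hg0 hJΨ
  have s2 := integral_mul_kubo_eq_of_coboundary hω hl hβ hγ hN hT hϑ0 h2ϑ hgc hJc hgc hΨ2 hCJ0 hCg0 hCΨ0 hCL0
    hgb hJb hgb hΨb hLb ((N : ℝ) - 1) hJeq hg0 hJ0 hg0 hgΨ
  -- Fubini
  have hFJJ := integral_Ioi_integral_nice_mul_act hω hl hβ hγ hN0 hT hϑ0 h2ϑ hJc hJc hCJ0 hJb hJb hJ0
  have hFJg := integral_Ioi_integral_nice_mul_act hω hl hβ hγ hN0 hT hϑ0 h2ϑ hJc hgc hCg0 hJb hgb hg0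
  have hFgJ := integral_Ioi_integral_nice_mul_act hω hl hβ hγ hN0 hT hϑ0 h2ϑ hgc hJc hCJ0 hgb hJb hJ0
  have hFgg := integral_Ioi_integral_nice_mul_act hω hl hβ hγ hN0 hT hϑ0 h2ϑ hgc hgc hCg0 hgb hgb hg0
  -- kernel detailed balance: `∫₀^∞ ∫ J P_t g₀ = ∫₀^∞ ∫ g₀ P_t J`
  have hflip : ∫ t in Ioi (0 : ℝ), ∫ z, J z * (∫ y, g₀ y ∂(P.transitionKernel N T T t.toNNReal z)) ∂μ =
      ∫ t in Ioi (0 : ℝ), ∫ z, g₀ z * (∫ y, J y ∂(P.transitionKernel N T T t.toNNReal z)) ∂μ := by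
    refine setIntegral_congr_fun measurableSet_Ioi fun t ht => ?_
    rw [pinnedChain_integral_mul_act_flip hω hl hβ hγ hN hT hϑ0 h2ϑ hJc hgc hCJ0 hCg0 hJb hgb (le_of_lt ht)]
    simp only [hgodd, hJodd, integral_neg, mul_neg, neg_mul, neg_neg]
    rfl
  -- assemble
  simp_rw [hJ0, hg0, mul_zero, sub_zero]
  rw [hFJJ, hFgg, s1, ← hFJg, hflip, hFgJ, s2]
  ring

/-- **`corr(g₀,g₀) ∈ L¹(0,∞)`** for the boundary power `g₀ = p_0 ∂_{q_0}H` (nice observable, exponential mixing of the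
equilibrium kernels). [cite: CuneoEckmannHairerReyBellet2018, Thm 2.13 (3)] -/
theorem integrableOn_corr_boundaryPower :
    IntegrableOn (fun t : ℝ =>
      (∫ z, (z.2 ⟨0, by omega⟩ * partialQ ⟨0, by omega⟩ ((pinnedChain ω₂ lam β γ).hamiltonian N) z) *
          (∫ y, y.2 ⟨0, by omega⟩ * partialQ ⟨0, by omega⟩ ((pinnedChain ω₂ lam β γ).hamiltonian N) y
            ∂((pinnedChain ω₂ lam β γ).transitionKernel N T T t.toNNReal z))
        ∂((pinnedChain ω₂ lam β γ).gibbsMeasure N T)) -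
        (∫ z, z.2 ⟨0, by omega⟩ * partialQ ⟨0, by omega⟩ ((pinnedChain ω₂ lam β γ).hamiltonian N) z
            ∂((pinnedChain ω₂ lam β γ).gibbsMeasure N T)) *
          (∫ z, z.2 ⟨0, by omega⟩ * partialQ ⟨0, by omega⟩ ((pinnedChain ω₂ lam β γ).hamiltonian N) z
            ∂((pinnedChain ω₂ lam β γ).gibbsMeasure N T))) (Ioi 0) := by
  have hN0 : 0 < N := by omega
  have hT1 : 0 < 1 / T := by positivity
  have hϑ0 : 0 < 1 / T / 4 := by positivity
  have h2ϑ : 2 * (1 / T / 4) < 1 / T := by linarith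
  obtain ⟨Cg, hCg0, hgb⟩ := abs_boundaryPower_le hω hl hβ.le hγ.le hN0 hϑ0
  exact pinnedChain_integrableOn_corr_nice hω hl hβ hγ hN0 hT hϑ0 h2ϑ
    (continuous_boundaryPower ω₂ lam β γ hN0) (continuous_boundaryPower ω₂ lam β γ hN0) hCg0 hCg0 hgb hgb

end Pinned

/-- **STUB `stub_boundaryGreenKubo` of line `cayley-pencil`** (crux `ContactStieltjesMeasure.StieltjesRepresentation`):
the open-chain Green–Kubo formula in BOUNDARY-POWER form. For `pinnedChain ω₂ lam β γ` (all parameters `> 0`), under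
weak-NESS uniqueness, along every steady family, for `T > 0` and `N ≥ 2`: `corr(g₀,g₀) ∈ L¹(0,∞)` for the boundary power
`g₀ = p_0 ∂_{q_0}H`, and the two-terminal response quotient converges to `(N-1)·(∫₀^∞ corr(g₀,g₀))/T²`. From the landed
`openChainGreenKubo_holds` (limit `∫₀^∞corr(J,J)/((N-1)T²)`) and `∫₀^∞corr(J,J) = (N-1)²∫₀^∞corr(g₀,g₀)`.
[cite: KunduDharNarayan2009, p. 3] [cite: CuneoEckmannHairerReyBellet2018, Thm 2.13] -/
theorem stub_boundaryGreenKubo :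
    ∀ ω₂ lam β γ : ℝ, 0 < ω₂ → 0 < lam → 0 < β → 0 < γ →
      (∀ (N : ℕ) (T_L T_R : ℝ), 0 < T_L → 0 < T_R → ∀ μ ν : Measure (PhaseSpace N),
        (pinnedChain ω₂ lam β γ).IsSteadyState N T_L T_R μ →
        (pinnedChain ω₂ lam β γ).IsSteadyState N T_L T_R ν → μ = ν) →
      ∀ μf : (N : ℕ) → ℝ → ℝ → Measure (PhaseSpace N),
        (∀ (N : ℕ) (T_L T_R : ℝ), 0 < T_L → 0 < T_R →
          (pinnedChain ω₂ lam β γ).IsSteadyState N T_L T_R (μf N T_L T_R)) →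
      ∀ T : ℝ, 0 < T → ∀ (N : ℕ) (hN : 2 ≤ N),
        let P := pinnedChain ω₂ lam β γ
        let X := PhaseSpace N
        let μ : Measure X := P.gibbsMeasure N T
        let g₀ : X → ℝ := fun z => z.2 ⟨0, by omega⟩ * partialQ ⟨0, by omega⟩ (P.hamiltonian N) z
        let corr : ℝ → ℝ := fun t =>
          (∫ z, g₀ z * (∫ y, g₀ y ∂(P.transitionKernel N T T t.toNNReal z)) ∂μ) - (∫ z, g₀ z ∂μ) * (∫ z, g₀ z ∂μ)
        IntegrableOn corr (Set.Ioi 0) ∧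
          Tendsto (fun δ : ℝ => P.totalCurrent (μf N (T + δ / 2) (T - δ / 2)) / δ) (𝓝[≠] 0)
            (𝓝 (((N : ℝ) - 1) * ((∫ t in Set.Ioi (0 : ℝ), corr t) / T ^ 2))) := by
  intro ω₂ lam β γ hω hl hβ hγ hU μf hμf T hT N hN
  obtain ⟨-, h2⟩ := openChainGreenKubo_holds ω₂ lam β γ hω hl hβ hγ hU μf hμf T hT N hN
  refine ⟨integrableOn_corr_boundaryPower hω hl.le hβ hγ hN hT, ?_⟩
  have key := integral_corr_totalCurrent_eq_sq_mul_boundaryPower hω hl.le hβ hγ hN hT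
  have hN1 : (N : ℝ) - 1 ≠ 0 := by
    have : (2 : ℝ) ≤ N := by exact_mod_cast hN
    linarith
  convert h2 using 2
  rw [key]
  field_simp

/-- **Registered sub-goal `stub_boundaryGreenKubo_zeta`**: `stub_boundaryGreenKubo` with its `let` gadgets
(`P`, `X`, `μ`, `g₀`, `corr`) zeta-expanded — the same proposition, registered in `let`-free form so that the gate can
match it textually. [cite: KunduDharNarayan2009, p. 3] [cite: CuneoEckmannHairerReyBellet2018, Thm 2.13] -/
theorem stub_boundaryGreenKubo_zeta :
    ∀ ω₂ lam β γ : ℝ, 0 < ω₂ → 0 < lam → 0 < β → 0 < γ →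
    (∀ (N : ℕ) (T_L T_R : ℝ), 0 < T_L → 0 < T_R → ∀ μ ν : Measure (PhaseSpace N),
      (pinnedChain ω₂ lam β γ).IsSteadyState N T_L T_R μ →
      (pinnedChain ω₂ lam β γ).IsSteadyState N T_L T_R ν → μ = ν) →
    ∀ μf : (N : ℕ) → ℝ → ℝ → Measure (PhaseSpace N),
      (∀ (N : ℕ) (T_L T_R : ℝ), 0 < T_L → 0 < T_R →
        (pinnedChain ω₂ lam β γ).IsSteadyState N T_L T_R (μf N T_L T_R)) →
    ∀ T : ℝ, 0 < T → ∀ (N : ℕ) (hN : 2 ≤ N),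
      IntegrableOn (fun t : ℝ =>
        (∫ z, (z.2 ⟨0, by omega⟩ * partialQ ⟨0, by omega⟩ ((pinnedChain ω₂ lam β γ).hamiltonian N) z) *
            (∫ y, y.2 ⟨0, by omega⟩ * partialQ ⟨0, by omega⟩ ((pinnedChain ω₂ lam β γ).hamiltonian N) y
              ∂((pinnedChain ω₂ lam β γ).transitionKernel N T T t.toNNReal z)) ∂((pinnedChain ω₂ lam β γ).gibbsMeasure N T)) -
          (∫ z, z.2 ⟨0, by omega⟩ * partialQ ⟨0, by omega⟩ ((pinnedChain ω₂ lam β γ).hamiltonian N) z ∂((pinnedChain ω₂ lam β γ).gibbsMeasure N T)) *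
            (∫ z, z.2 ⟨0, by omega⟩ * partialQ ⟨0, by omega⟩ ((pinnedChain ω₂ lam β γ).hamiltonian N) z ∂((pinnedChain ω₂ lam β γ).gibbsMeasure N T))) (Set.Ioi 0) ∧
      Tendsto (fun δ : ℝ => (pinnedChain ω₂ lam β γ).totalCurrent (μf N (T + δ / 2) (T - δ / 2)) / δ) (𝓝[≠] 0)
        (𝓝 (((N : ℝ) - 1) * ((∫ t in Set.Ioi (0 : ℝ),
            (∫ z, (z.2 ⟨0, by omega⟩ * partialQ ⟨0, by omega⟩ ((pinnedChain ω₂ lam β γ).hamiltonian N) z) *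
                (∫ y, y.2 ⟨0, by omega⟩ * partialQ ⟨0, by omega⟩ ((pinnedChain ω₂ lam β γ).hamiltonian N) y
                  ∂((pinnedChain ω₂ lam β γ).transitionKernel N T T t.toNNReal z)) ∂((pinnedChain ω₂ lam β γ).gibbsMeasure N T)) -
              (∫ z, z.2 ⟨0, by omega⟩ * partialQ ⟨0, by omega⟩ ((pinnedChain ω₂ lam β γ).hamiltonian N) z ∂((pinnedChain ω₂ lam β γ).gibbsMeasure N T)) *
                (∫ z, z.2 ⟨0, by omega⟩ * partialQ ⟨0, by omega⟩ ((pinnedChain ω₂ lam β γ).hamiltonian N) z ∂((pinnedChain ω₂ lam β γ).gibbsMeasure N T))) / T ^ 2))) :=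
  fun ω₂ lam β γ hω hl hβ hγ hU μf hμf T hT N hN => stub_boundaryGreenKubo ω₂ lam β γ hω hl hβ hγ hU μf hμf T hT N hN

end Summit.AtomisticToContinuum.FouriersLaw.Theorems.ContactStieltjesMeasure.CayleyPencil

end
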